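import Summits.ValiantsHypothesis.ValiantsHypothesis.Theses.RealTau
import Literature.Computability.AlgebraicComplexity.DepthThreeChasmGKKSProofs
import Literature.Computability.AlgebraicComplexity.RealTauKnownCases

/-!
# Stub `stub_fischer` of line `fischer-powers` for the crux `RealTauRefined`

The Fischer / Ryser step (Tavenas 2014, Lemme 3.26) of the line `fischer-powers` on the refined real
τ-conjecture `RealTauRefined` (stmt-ValiantsHypothesis-18101): if nonzero signed sums
`Σ_{i<K} ε_i h_i^m` (`ε_i = ±1`, `h_i` real `T`-sparse) have at most `2^(a(m+1)) (K+T+2)^a` distinct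
real zeros for one absolute `a`, then nonzero sums of products `Σ_{i<k} Π_{j<m} f_ij` (`f_ij` real
`t`-sparse) have at most `2^(a'(m+1)) (k+t+2)^a'` distinct real zeros for one absolute `a'` (we take
`a' = 2a`).

Proof: by the tree's `DepthThreeChasm.fischer_ryser` (with `s = univ : Finset (Fin m)`),
`m! * Π_j f_ij = Σ_{S ⊆ [m]} (-1)^(m-|S|) (Σ_{j∈S} f_ij)^m`, so `C m! * F` is a signed sum of `k 2^m`
`m`-th powers of `(m t)`-sparse polynomials (reindex `Fin k × Finset (Fin m) ≃ Fin (k 2^m)`); it has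
the same roots as `F`, and `k 2^m + m t + 2 ≤ 2^m (k+t+2)` re-absorbs the bound into exponent `2a`.
The signs are written as `Int.negOnePow`, whose cast to `ℝ` is `(-1)^·` (`Int.cast_negOnePow_natCast`).
-/

noncomputable section

set_option linter.dupNamespace false

namespace Summit.ValiantsHypothesis.ValiantsHypothesis.Theorems.RealTauRealTauRefined

open Polynomial Finset
open Literature.Computability.AlgebraicComplexity

/-- Fischer's identity over `Fin m`, summed over all subsets: for `y : Fin m → A`,
`m! * Π_j y_j = Σ_{S : Finset (Fin m)} (-1)^(m - |S|) (Σ_{j ∈ S} y_j)^m`. -/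
theorem fischer_ryser_univ {A : Type*} [CommRing A] (m : ℕ) (y : Fin m → A) :
    (m.factorial : A) * ∏ j, y j =
      ∑ S : Finset (Fin m), (-1 : A) ^ (m - S.card) * (∑ j ∈ S, y j) ^ m := by
  have h := DepthThreeChasm.fischer_ryser y (univ : Finset (Fin m))
  simp only [Finset.card_univ, Fintype.card_fin, Finset.powerset_univ] at h
  exact h

/-- The sign `Int.negOnePow j ∈ ℤˣ`, cast to `ℝ` and then to a constant polynomial, is `(-1)^j`. -/
theorem C_cast_negOnePow (j : ℕ) :
    C ((((j : ℤ).negOnePow : ℤ) : ℝ)) = (-1 : Polynomial ℝ) ^ j := by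
  rw [Int.cast_negOnePow_natCast, map_pow, map_neg, map_one]

/-- The arithmetic re-absorption `2^(a(m+1)) (k 2^m + m t + 2)^a ≤ 2^(2a(m+1)) (k+t+2)^(2a)`. -/
theorem reabsorb_bound (a k m t : ℕ) :
    2 ^ (a * (m + 1)) * (k * 2 ^ m + m * t + 2) ^ a ≤
      2 ^ (2 * a * (m + 1)) * (k + t + 2) ^ (2 * a) := by
  have hm : m ≤ 2 ^ m := (Nat.lt_two_pow_self).le
  have h1 : 1 ≤ 2 ^ m := Nat.one_le_two_pow
  have hbase : k * 2 ^ m + m * t + 2 ≤ 2 ^ m * (k + t + 2) := by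
    have : m * t ≤ 2 ^ m * t := Nat.mul_le_mul_right t hm
    nlinarith
  have hpow : (k * 2 ^ m + m * t + 2) ^ a ≤ 2 ^ (m * a) * (k + t + 2) ^ a := by
    calc (k * 2 ^ m + m * t + 2) ^ a ≤ (2 ^ m * (k + t + 2)) ^ a := Nat.pow_le_pow_left hbase a
      _ = 2 ^ (m * a) * (k + t + 2) ^ a := by rw [mul_pow, ← pow_mul]
  have hexp : 2 ^ (a * (m + 1)) * 2 ^ (m * a) ≤ 2 ^ (2 * a * (m + 1)) := by
    rw [← pow_add]
    exact Nat.pow_le_pow_right (by norm_num) (by nlinarith)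
  have hkt : (k + t + 2) ^ a ≤ (k + t + 2) ^ (2 * a) :=
    Nat.pow_le_pow_right (by omega) (by omega)
  calc 2 ^ (a * (m + 1)) * (k * 2 ^ m + m * t + 2) ^ a
      ≤ 2 ^ (a * (m + 1)) * (2 ^ (m * a) * (k + t + 2) ^ a) := Nat.mul_le_mul_left _ hpow
    _ = (2 ^ (a * (m + 1)) * 2 ^ (m * a)) * (k + t + 2) ^ a := by ring
    _ ≤ 2 ^ (2 * a * (m + 1)) * (k + t + 2) ^ (2 * a) := Nat.mul_le_mul hexp hkt

/-- **Fischer / Ryser step (Tavenas 2014, Lemme 3.26; `EqualPowerSigned → RealTauRefined`).**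
If nonzero signed sums `Σ_{i<K} ε_i h_i^m` of `m`-th powers of real `T`-sparse polynomials have at
most `2^(a(m+1)) (K+T+2)^a` distinct real zeros for one absolute `a`, then nonzero sums of `k`
products of `m` real `t`-sparse polynomials have at most `2^(a'(m+1)) (k+t+2)^a'` distinct real zeros
for one absolute `a'` (namely `a' = 2a`): `C m! * F = Σ_{i<k} Σ_{S ⊆ [m]} (-1)^(m-|S|) (Σ_{j∈S} f_ij)^m`
is a signed sum of `k 2^m` `m`-th powers of `(m t)`-sparse polynomials with the same roots as `F`,
and `k 2^m + m t + 2 ≤ 2^m (k+t+2)`. -/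
theorem stub_fischer :
    (∃ a : ℕ, ∀ (K m T : ℕ) (ε : Fin K → ℤˣ) (h : Fin K → Polynomial ℝ),
      (∀ i, (h i).support.card ≤ T) →
        (∑ i, C (((ε i : ℤ) : ℝ)) * h i ^ m) ≠ 0 →
          (∑ i, C (((ε i : ℤ) : ℝ)) * h i ^ m).roots.toFinset.card
            ≤ 2 ^ (a * (m + 1)) * (K + T + 2) ^ a) →
    ∃ a : ℕ, ∀ (k m t : ℕ) (f : Fin k → Fin m → Polynomial ℝ), (∀ i j, (f i j).support.card ≤ t) →
      (∑ i, ∏ j, f i j) ≠ 0 →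
        (∑ i, ∏ j, f i j).roots.toFinset.card ≤ 2 ^ (a * (m + 1)) * (k + t + 2) ^ a := by
  rintro ⟨a, ha⟩
  refine ⟨2 * a, ?_⟩
  intro k m t f hf hF
  classical
  -- reindex `Fin k × Finset (Fin m)` by `Fin (k * 2 ^ m)`
  have hcard : Fintype.card (Fin k × Finset (Fin m)) = k * 2 ^ m := by
    simp [Fintype.card_prod, Fintype.card_fin, Fintype.card_finset]
  let σ : Fin k × Finset (Fin m) ≃ Fin (k * 2 ^ m) := Fintype.equivFinOfCardEq hcard
  -- signs `(-1)^(m - |S|)` and inner sums `Σ_{j ∈ S} f i j`, indexed by `n = σ (i, S)`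
  let ε : Fin (k * 2 ^ m) → ℤˣ := fun n => ((m - (σ.symm n).2.card : ℕ) : ℤ).negOnePow
  let h : Fin (k * 2 ^ m) → Polynomial ℝ := fun n => ∑ j ∈ (σ.symm n).2, f (σ.symm n).1 j
  -- each `h n` is `(m t)`-sparse
  have hsupp : ∀ n, (h n).support.card ≤ m * t := by
    intro n
    calc (h n).support.card ≤ ∑ j ∈ (σ.symm n).2, (f (σ.symm n).1 j).support.card :=
          card_support_sum_le _ _
      _ ≤ ∑ _j ∈ (σ.symm n).2, t := sum_le_sum fun j _ => hf _ j
      _ = (σ.symm n).2.card * t := by simp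
      _ ≤ m * t := Nat.mul_le_mul_right t (card_finset_fin_le _)
  -- the Fischer identity, summed over `i` and reindexed
  have hkey : (∑ n, C (((ε n : ℤ) : ℝ)) * h n ^ m) =
      C ((m.factorial : ℕ) : ℝ) * ∑ i, ∏ j, f i j := by
    calc (∑ n, C (((ε n : ℤ) : ℝ)) * h n ^ m)
        = ∑ n, ((-1 : Polynomial ℝ) ^ (m - (σ.symm n).2.card) *
            (∑ j ∈ (σ.symm n).2, f (σ.symm n).1 j) ^ m) := by
          refine sum_congr rfl fun n _ => ?_
          simp only [ε, h, C_cast_negOnePow]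
      _ = ∑ p : Fin k × Finset (Fin m),
            (-1 : Polynomial ℝ) ^ (m - p.2.card) * (∑ j ∈ p.2, f p.1 j) ^ m :=
          Equiv.sum_comp σ.symm (fun p : Fin k × Finset (Fin m) =>
            (-1 : Polynomial ℝ) ^ (m - p.2.card) * (∑ j ∈ p.2, f p.1 j) ^ m)
      _ = ∑ i : Fin k, ∑ S : Finset (Fin m),
            (-1 : Polynomial ℝ) ^ (m - S.card) * (∑ j ∈ S, f i j) ^ m :=
          Fintype.sum_prod_type _
      _ = ∑ i : Fin k, ((m.factorial : ℕ) : Polynomial ℝ) * ∏ j, f i j :=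
          sum_congr rfl fun i _ => (fischer_ryser_univ m (f i)).symm
      _ = C ((m.factorial : ℕ) : ℝ) * ∑ i, ∏ j, f i j := by
          rw [Polynomial.C_eq_natCast, Finset.mul_sum]
  -- nonvanishing and roots of `C m! * F`
  have hm0 : ((m.factorial : ℕ) : ℝ) ≠ 0 := Nat.cast_ne_zero.mpr (Nat.factorial_ne_zero m)
  have hne : (∑ n, C (((ε n : ℤ) : ℝ)) * h n ^ m) ≠ 0 := by
    rw [hkey]
    exact mul_ne_zero (Polynomial.C_ne_zero.mpr hm0) hF
  have hroots : (∑ n, C (((ε n : ℤ) : ℝ)) * h n ^ m).roots = (∑ i, ∏ j, f i j).roots := by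
    rw [hkey, Polynomial.roots_C_mul _ hm0]
  have hb := ha (k * 2 ^ m) m (m * t) ε h hsupp hne
  rw [hroots] at hb
  exact hb.trans (reabsorb_bound a k m t)

end Summit.ValiantsHypothesis.ValiantsHypothesis.Theorems.RealTauRealTauRefined
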